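import Literature.NumberTheory.LFunctions.KMVDerivLambdaIntegral
import Literature.NumberTheory.LFunctions.KMVAfeLogSeries
import Literature.NumberTheory.LFunctions.KMVCentralValueSquaredAFEHead
import Literature.NumberTheory.EllipticCurves.CuspFormFrickeAxisIntegral
import Literature.NumberTheory.EllipticCurves.PAdicLFunctionNonvanishingProofs
import Literature.NumberTheory.EllipticCurves.CuspFormLFunctionNewformFrickeProofs
import HarnessLib

/-!
# KMV 2000 (21)–(22) at EVERY order `k` — PROOF: `KMV2000.kmv2000_eq22_holds` and
# the weight decay `KMV2000.afeW_decay_holds` (discharge of two named statements)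

Source: E. Kowalski, P. Michel, J. VanderKam, *Non-vanishing of high derivatives of automorphic
`L`-functions at the center of the critical strip*, J. reine angew. Math. 526 (2000) 1–34, §5 p. 12,
(21)–(22) [held: paper:doi-10-1515-crll-2000-074]: «The functional equation for `Λ(f, 1/2 + s)` has
always sign `+1` so manipulations similar as those performed in the previous section yield
`Λ^{(k)}(f,1/2)² = 2q̂ Σ_{n₁,n₂} λ_f(n₁)λ_f(n₂)(n₁n₂)^{−1/2} (1/2πi)∫_{(3)} (q̂ᵗΓ(1+t)n₁^{−t})^{(k)} (q̂ᵗΓ(1+t)n₂^{−t})^{(k)} dt/t`»,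
and (22)/(15): the weight «decays faster than any negative power of `y`».
Cell landau-siegel / ls-inputs, line H-AFE2 (K-INPUTS-11 (1)); fact skeleton `log-fricke-split` (crux
workfile `Cruxes/BeyondDiagonalBeatsQuarter/Lines/log_fricke_split.lean` on stmt-Parity-20343), seat
ls-inputs-Hafe-lead g1 (all five stubs and the assembly).

## The proof (real-variable; the `k = 0` case is `KMVCentralValueSquaredAFEProofs`)

Let `f ∈ S₂(Γ₀(N))` with `w_N f = ε f`, `ε² = 1`, `G_k(y) = f(iy)(log(√N y))^k`, `A_k = ∫_0^∞ G_k`,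
`H_k(y) = ∫_0^y G_k`, `T_k(y) = ∫_{v > 1/(Ny)} G_k`.
* T1 `KMV2000.derivLambda_eq_integral`: `Λ^{(k)}(f,½) = 2π q̂^{1/2} A_k` (and `G_k ∈ L¹`).
* T3 `KMV2000.afeW_eq_logCutoffW` + T4 `KMV2000.hasSum_logCutoffW_afe`:
  `Σ_{ℕ×ℕ} afeTerm q f k k = 4π² ∫_0^∞ G_k·T_k` (absolutely), the Mellin–Barnes weight being the
  closed real form `logCutoffW`.
* T2 `IsFrickeEigen.integral_imagAxis_Ioi_inv_mul_logPow`: `T_k(y) = (−1)^k(−ε) H_k(y)`.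
* head `KMV2000.integral_Ioi_mul_integral_Ioc_eq_sq_div_two`: `∫_0^∞ G_k·H_k = A_k²/2`.
* `(−1)^{k+1} ε A_k = A_k` (T2 at `y = 1/√N` and `ε² = 1`).
Hence `2q̂ Σ = 2q̂·4π²·(−1)^{k+1}εA_k²/2 = 4π² q̂ A_k² = Λ^{(k)}(f,½)²`: sign `+1` at every `k`.
* T5 `KMV2000.abs_logCutoffW_le` (Rankin) + T3: `‖afeW q̂ i j n₁ n₂‖ ≤ C (q̂²/n₁n₂)^A (1+|log q̂/n₁|)^i (1+|log q̂/n₂|)^j`.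

## Results

* `KMV2000.derivLambda_sq_eq_tsum_afeTerm_of_fricke` — (22) at order `k` for EVERY level `N ≥ 1` and
  every `f ∈ S₂(Γ₀(N))` with `w_N f = εf`, `ε² = 1`; `…_of_mem_newforms0` — newforms of any level.
* `KMV2000.kmv2000_eq22_holds : kmv2000_eq22` — the printed fact (prime level), all orders.
* `KMV2000.afeW_decay_holds : afeW_decay` — the weight decay, all orders, uniform in `q̂`.
No named fact is used: both statements are now kernel theorems (net debt −2).
-/

noncomputable section

open scoped Real
open Complex Set MeasureTheory Filter CongruenceSubgroup UpperHalfPlane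
open Literature.NumberTheory.EllipticCurves.ModularForms

namespace Literature.NumberTheory.LFunctions.KMV2000

variable {N : ℕ} [NeZero N]

/-! ### The summand of (22) in closed real form -/

/-- **The summand of (22) is the real-form summand**: for every `f ∈ S₂(Γ₀(N))`, `k`, and
`n ∈ ℕ × ℕ`, `afeTerm N f k k n₁ n₂ = λ_f(n₁)λ_f(n₂)(n₁n₂)^{−1/2} W_{kk}(log q̂/n₁, log q̂/n₂; n₁n₂/q̂²)`
(the bridge `afeW_eq_logCutoffW` off the axes; both sides vanish on the axes since `λ_f(0) = 0`).
[cite: KowalskiMichelVanderKam2000, (21)–(22) p. 12] -/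
theorem afeTerm_eq_logCutoffW (f : CuspForm (Gamma0 N) 2) (k : ℕ) (n : ℕ × ℕ) :
    afeTerm N f k k n.1 n.2 =
      GL2Family.heckeLambda f n.1 * GL2Family.heckeLambda f n.2 *
          ((((n.1 : ℝ) * n.2) ^ (-(1 / 2 : ℝ)) : ℝ) : ℂ) *
          ((logCutoffW k k (Real.log (qhat N / n.1)) (Real.log (qhat N / n.2))
            ((n.1 : ℝ) * n.2 / qhat N ^ 2) : ℝ) : ℂ) := by
  obtain ⟨n₁, n₂⟩ := n
  by_cases h : n₁ = 0 ∨ n₂ = 0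
  · rw [afeTerm, if_pos h]
    rcases h with h | h
    · simp [h, heckeLambda_zero]
    · simp [h, heckeLambda_zero]
  · have h' := not_or.mp h
    rw [afeTerm, if_neg h, afeW_eq_logCutoffW (qhat_pos_of_neZero N) k k h'.1 h'.2]

/-! ### The log-weighted axis function -/

/-- `G_k(y) = f(iy)(log(√N y))^k` is continuous on `(0, ∞)`. [cite: KowalskiMichelVanderKam2000, (13) p. 9] -/
theorem continuousOn_imagAxis_mul_logPow (f : CuspForm (Gamma0 N) 2) (k : ℕ) :
    ContinuousOn (fun y : ℝ ↦ f (UpperHalfPlane.ofComplex (Complex.I * y)) *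
      (((Real.log (Real.sqrt N * y)) ^ k : ℝ) : ℂ)) (Ioi 0) := by
  have h1 : ContinuousOn (fun y : ℝ ↦ f (UpperHalfPlane.ofComplex (Complex.I * y))) (Ioi 0) := by
    have hc : ContinuousOn ((f : ℍ → ℂ) ∘ UpperHalfPlane.ofComplex) {z : ℂ | 0 < z.im} :=
      (UpperHalfPlane.mdifferentiable_iff.mp (CuspFormClass.holo f)).continuousOn
    have h2 : ContinuousOn (fun t : ℝ ↦ Complex.I * t) (Ioi 0) := by fun_prop
    exact hc.comp h2 fun t ht ↦ by simpa using ht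
  refine h1.mul ?_
  have hN : (0 : ℝ) < Real.sqrt N := Real.sqrt_pos.mpr (by exact_mod_cast NeZero.pos N)
  refine Complex.continuous_ofReal.comp_continuousOn (ContinuousOn.pow ?_ k)
  refine Real.continuousOn_log.comp (by fun_prop) ?_
  intro y hy
  exact (mul_pos hN hy).ne'

omit [NeZero N] in
/-- `(1/√N)` is the self-dual split point: `(N · (1/√N))⁻¹ = 1/√N`. [cite: KowalskiMichelVanderKam2000, (21) p. 12] -/
theorem inv_mul_inv_sqrt_eq : ((N : ℝ) * (Real.sqrt N)⁻¹)⁻¹ = (Real.sqrt N)⁻¹ := by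
  rw [mul_inv, inv_inv, inv_mul_eq_div, Real.sqrt_div_self', one_div]

/-- **`(−1)^{k+1} ε A_k = A_k`** for `A_k = ∫_0^∞ f(iy)(log √N y)^k dy` when `f(-1/(Nτ)) = εNτ²f(τ)` and
`ε² = 1`: split at `1/√N` and flip the upper piece by the weighted Fricke symmetry
(`∫_{1/√N}^∞ G_k = (−1)^k(−ε)∫_0^{1/√N} G_k`). In particular `A_k = 0` when `(−1)^k ε = 1` — the parity
vanishing of `Λ^{(k)}(f,½)`. [cite: KowalskiMichelVanderKam2000, §1 p. 2 and (21)–(22) p. 12] -/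
theorem sign_mul_integral_imagAxis_mul_logPow (f : CuspForm (Gamma0 N) 2) (k : ℕ) {ε : ℂ}
    (hW : IsFrickeEigen N f ε) (hε : ε ^ 2 = 1) :
    (-1) ^ (k + 1) * ε * ∫ y in Ioi (0 : ℝ), f (UpperHalfPlane.ofComplex (Complex.I * y)) *
        (((Real.log (Real.sqrt N * y)) ^ k : ℝ) : ℂ) =
      ∫ y in Ioi (0 : ℝ), f (UpperHalfPlane.ofComplex (Complex.I * y)) *
        (((Real.log (Real.sqrt N * y)) ^ k : ℝ) : ℂ) := by
  set G : ℝ → ℂ := fun y ↦ f (UpperHalfPlane.ofComplex (Complex.I * y)) *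
    (((Real.log (Real.sqrt N * y)) ^ k : ℝ) : ℂ) with hG
  have hint : IntegrableOn G (Ioi 0) := integrableOn_imagAxis_mul_logPow f k
  set b : ℝ := (Real.sqrt N)⁻¹ with hb_def
  have hb : 0 < b := inv_pos.mpr (Real.sqrt_pos.mpr (by exact_mod_cast NeZero.pos N))
  have hsplit : ∫ t in Ioi (0 : ℝ), G t = (∫ t in Ioc 0 b, G t) + ∫ t in Ioi b, G t := by
    have h := intervalIntegral.integral_Ioi_sub_Ioi hint hb.le
    rw [intervalIntegral.integral_of_le hb.le] at h
    linear_combination h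
  have hflip : ∫ t in Ioi b, G t = (-1) ^ k * (-ε) * ∫ t in Ioc (0 : ℝ) b, G t := by
    have h := hW.integral_imagAxis_Ioi_inv_mul_logPow k hb
    rw [hb_def, inv_mul_inv_sqrt_eq] at h
    exact h
  have hP : ((-1 : ℂ) ^ k) ^ 2 = 1 := by
    rw [← pow_mul, show k * 2 = 2 * k by ring, pow_mul]
    norm_num
  show (-1) ^ (k + 1) * ε * ∫ t in Ioi (0 : ℝ), G t = ∫ t in Ioi (0 : ℝ), G t
  rw [hsplit, hflip]
  set X : ℂ := ∫ t in Ioc (0 : ℝ) b, G t with hX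
  linear_combination (((-1 : ℂ) ^ k) ^ 2 * X) * hε + X * hP

/-! ### (22) at every order, every level -/

/-- **KMV (21)–(22) at order `k` for every Fricke eigen-cusp-form, every level**: if `f ∈ S₂(Γ₀(N))`,
`w_N f = ε f` and `ε² = 1`, then for every `k` the double series `Σ_{ℕ×ℕ} afeTerm N f k k` converges
absolutely and `Λ^{(k)}(f,½)² = 2 q̂ Σ'_{ℕ×ℕ} λ_f(n₁)λ_f(n₂)(n₁n₂)^{−1/2} W_{kk}(q̂;n₁,n₂)`
(`q̂ = √N/2π`). [cite: KowalskiMichelVanderKam2000, (21)–(22) p. 12] -/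
theorem derivLambda_sq_eq_tsum_afeTerm_of_fricke (f : CuspForm (Gamma0 N) 2) {ε : ℂ}
    (hfr : frickeInvolution N 2 f = ε • f) (hε : ε ^ 2 = 1) (k : ℕ) :
    Summable (fun n : ℕ × ℕ ↦ ‖afeTerm N f k k n.1 n.2‖) ∧
      derivLambda N k f ^ 2 = 2 * (qhat N : ℂ) * ∑' n : ℕ × ℕ, afeTerm N f k k n.1 n.2 := by
  have hW : IsFrickeEigen N f ε := isFrickeEigen_of_frickeInvolution_eq_smul N hfr
  set G : ℝ → ℂ := fun y ↦ f (UpperHalfPlane.ofComplex (Complex.I * y)) *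
    (((Real.log (Real.sqrt N * y)) ^ k : ℝ) : ℂ) with hG
  have hint : IntegrableOn G (Ioi 0) := integrableOn_imagAxis_mul_logPow f k
  have hΛ : derivLambda N k f = 2 * (π : ℂ) * ((qhat N : ℝ) : ℂ) ^ (1 / 2 : ℂ) * ∫ y in Ioi (0 : ℝ), G y :=
    derivLambda_eq_integral f k
  have hS := hasSum_logCutoffW_afe f k
  have hfun : (fun n : ℕ × ℕ ↦ afeTerm N f k k n.1 n.2) =
      fun n : ℕ × ℕ ↦ GL2Family.heckeLambda f n.1 * GL2Family.heckeLambda f n.2 *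
          ((((n.1 : ℝ) * n.2) ^ (-(1 / 2 : ℝ)) : ℝ) : ℂ) *
          ((logCutoffW k k (Real.log (qhat N / n.1)) (Real.log (qhat N / n.2))
            ((n.1 : ℝ) * n.2 / qhat N ^ 2) : ℝ) : ℂ) :=
    funext (afeTerm_eq_logCutoffW f k)
  refine ⟨?_, ?_⟩
  · exact (summable_norm_iff.mpr hS.summable).congr fun n ↦ by rw [afeTerm_eq_logCutoffW f k n]
  -- the inner tail integral is `(-1)^k (-ε) ∫_{Ioc 0 y} G` on `Ioi 0` (T2)
  have hT : ∫ y in Ioi (0 : ℝ), G y * ∫ v in Ioi (((N : ℝ) * y)⁻¹), G v =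
      (-1) ^ k * (-ε) * ∫ y in Ioi (0 : ℝ), G y * ∫ u in Ioc (0 : ℝ) y, G u := by
    rw [← integral_const_mul]
    refine setIntegral_congr_fun measurableSet_Ioi fun y hy ↦ ?_
    simp only [hG]
    rw [hW.integral_imagAxis_Ioi_inv_mul_logPow k hy]
    ring
  -- the head integral (FTC for `H²/2`)
  have hH : ∫ y in Ioi (0 : ℝ), G y * ∫ u in Ioc (0 : ℝ) y, G u = (∫ y in Ioi (0 : ℝ), G y) ^ 2 / 2 :=
    integral_Ioi_mul_integral_Ioc_eq_sq_div_two hint (continuousOn_imagAxis_mul_logPow f k)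
  have hA := sign_mul_integral_imagAxis_mul_logPow f k hW hε
  have hsq : (((qhat N : ℝ) : ℂ) ^ (1 / 2 : ℂ)) ^ 2 = (qhat N : ℂ) := by
    rw [← cpow_nat_mul]
    norm_num
  rw [hfun, hS.tsum_eq, hΛ]
  change (2 * (π : ℂ) * ((qhat N : ℝ) : ℂ) ^ (1 / 2 : ℂ) * ∫ y in Ioi (0 : ℝ), G y) ^ 2 =
    2 * (qhat N : ℂ) * (4 * (π : ℂ) ^ 2 *
      ∫ y in Ioi (0 : ℝ), G y * ∫ v in Ioi (((N : ℝ) * y)⁻¹), G v)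
  rw [hT, hH, mul_pow, mul_pow, hsq]
  set A : ℂ := ∫ y in Ioi (0 : ℝ), G y with hA_def
  linear_combination (-4 : ℂ) * (π : ℂ) ^ 2 * (qhat N : ℂ) * A * hA

/-- **KMV (21)–(22) at order `k` for newforms of any level** `N ≥ 1` (`w_N f = ε_f f`, `ε_f = ±1` by
Atkin–Lehner: `IsNewform0.frickeInvolution_eq_smul_holds`, `…frickeEigenvalue_eq_one_or_eq_neg_one_holds`).
[cite: KowalskiMichelVanderKam2000, (21)–(22) p. 12] -/
theorem derivLambda_sq_eq_tsum_afeTerm_of_mem_newforms0 (f : CuspForm (Gamma0 N) 2)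
    (hf : f ∈ newforms0 N 2) (k : ℕ) :
    Summable (fun n : ℕ × ℕ ↦ ‖afeTerm N f k k n.1 n.2‖) ∧
      derivLambda N k f ^ 2 = 2 * (qhat N : ℂ) * ∑' n : ℕ × ℕ, afeTerm N f k k n.1 n.2 := by
  have hfr : frickeInvolution N 2 f = frickeEigenvalue f • f :=
    IsNewform0.frickeInvolution_eq_smul_holds hf
  have hε : frickeEigenvalue f ^ 2 = 1 := by
    rcases IsNewform0.frickeEigenvalue_eq_one_or_eq_neg_one_holds (N := N) (k := (2 : ℤ)) hf with
      h | h <;> rw [h] <;> norm_num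
  exact derivLambda_sq_eq_tsum_afeTerm_of_fricke f hfr hε k

/-- **Discharge of the named fact `KMV2000.kmv2000_eq22`** (KMV 2000 (21)–(22) at EVERY order `k`,
`q` prime, `f ∈ S₂(q)^*`): a kernel theorem — the fact is no longer an input.
[cite: KowalskiMichelVanderKam2000, (21)–(22) p. 12] -/
theorem kmv2000_eq22_holds : kmv2000_eq22 :=
  fun q _ _ f hf k ↦ derivLambda_sq_eq_tsum_afeTerm_of_mem_newforms0 (N := q) f hf k

/-! ### The weight decay, every order, uniform in `q̂` -/

/-- **The all-order AFE weight decays faster than any negative power, with an explicit constant**: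
for `A ≥ 0`, `q̂ > 0`, `n₁, n₂ ≥ 1`,
`‖afeW q̂ i j n₁ n₂‖ ≤ C_{A,i}C_{A,j} (q̂²/n₁n₂)^A (1+|log q̂/n₁|)^i (1+|log q̂/n₂|)^j`,
`C_{A,i} = ∫_0^∞ x^A e^{−x} 2^i (1+|log x|^i) dx` (bridge `afeW_eq_logCutoffW` + Rankin `abs_logCutoffW_le`).
[cite: KowalskiMichelVanderKam2000, (22) p. 12 and (15) p. 9] -/
theorem norm_afeW_le {qh : ℝ} (hqh : 0 < qh) (i j : ℕ) {A : ℝ} (hA : 0 ≤ A) {n₁ n₂ : ℕ}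
    (hn₁ : n₁ ≠ 0) (hn₂ : n₂ ≠ 0) :
    ‖afeW qh i j n₁ n₂‖ ≤
      ((∫ x in Ioi (0 : ℝ), x ^ A * (Real.exp (-x) * (2 ^ i * (1 + |Real.log x| ^ i)))) *
        ∫ x in Ioi (0 : ℝ), x ^ A * (Real.exp (-x) * (2 ^ j * (1 + |Real.log x| ^ j)))) *
      (qh ^ 2 / ((n₁ : ℝ) * n₂)) ^ A * (1 + |Real.log (qh / n₁)|) ^ i * (1 + |Real.log (qh / n₂)|) ^ j := by
  have h₁ : (0 : ℝ) < n₁ := by exact_mod_cast Nat.pos_of_ne_zero hn₁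
  have h₂ : (0 : ℝ) < n₂ := by exact_mod_cast Nat.pos_of_ne_zero hn₂
  have hy : 0 < (n₁ : ℝ) * n₂ / qh ^ 2 := by positivity
  rw [afeW_eq_logCutoffW hqh i j hn₁ hn₂, Complex.norm_real, Real.norm_eq_abs]
  have hpow : ((n₁ : ℝ) * n₂ / qh ^ 2) ^ (-A) = (qh ^ 2 / ((n₁ : ℝ) * n₂)) ^ A := by
    rw [Real.rpow_neg hy.le, ← Real.inv_rpow hy.le, inv_div]
  have h := abs_logCutoffW_le i j hA (Real.log (qh / n₁)) (Real.log (qh / n₂)) hy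
  rwa [hpow] at h

/-- **Discharge of the named statement `KMV2000.afeW_decay`** (KMV 2000 (22) p. 12 / (15) p. 9, every
order, uniform in `q̂`): a kernel theorem. [cite: KowalskiMichelVanderKam2000, (22) p. 12 and (15) p. 9] -/
theorem afeW_decay_holds : afeW_decay :=
  fun i j _ hA ↦ ⟨_, fun _ hqh _ _ hn₁ hn₂ ↦ norm_afeW_le hqh i j hA hn₁ hn₂⟩

end Literature.NumberTheory.LFunctions.KMV2000

end
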